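import Literature.MathematicalPhysics.QuantumFieldTheory.Balaban1983to89.B8LeafKnitZd3FourPrinted
import Literature.MathematicalPhysics.QuantumFieldTheory.Balaban1983to89.B8Thm2TorusAtSupplier

/-!
# `Balaban1983to89.B8Thm2TorusAtLetters` — [Balaban1985RegularSpaces] THEOREM 2 (p. 83) FOR `Ω_j = T_η` FROM [4]'s LETTERS AT THE TORUS MEMBERS: the
# existence half of `B8Thm2TorusAt` (`B8Thm2TorusAtSupplier.thm2TorusAt_exists_of_socketsE`) with the two Proposition-5 sockets and the uniqueness socket
# DISCHARGED from the letters of record (`B8SockLettersRD.SockLettersRD`, the guarded uniqueness letters, the all-levels b9 socket) by the tree's providers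
# `exists_threshold_sockHFP_pairRD` ∕ `exists_threshold_sockP5uEB`, the torus index laws proved — modules M3 + M4′ of `lit-balaban-p33/T2S-MAP.md`
# (sub-row «G-B8-T2S»; the hypotheses left are EXACTLY the deliverables of sub-row «G-B9-LETTERS», `lit-balaban-r06/B9-LETTERS-MAP.md`)

statement-level skeleton of published theorems with citation tags; proofs where landed; nothing here is a claim about the
Yang–Mills mass gap

T. Bałaban, *Spaces of regular gauge field configurations on a lattice and gauge fixing conditions*, Commun. Math. Phys. **99** (1985) 75–102
`[Balaban1985RegularSpaces]`: Theorem 2 p. 83, (1.33)–(1.39) pp. 82–83, Prop. 5 (1.106)–(1.109) p. 94, Thm 4 p. 88; [4] = T. Bałaban, *Propagators for lattice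
gauge theories in a background field*, Commun. Math. Phys. **99** (1985) 389–434 `[Balaban1985BackgroundPropagators]`: Thm 3.1 p. 397, Thm 3.3 p. 398.
STATUS: published, refereed.

CITATION HEADER (lean-in-tree rule).  Cell `lit-balaban`, seat `lit-balaban-p33` (gen 90), sub-row «G-B8-T2S» ([B8] §3 Theorem 2 torus supplier for R3
`stmt-QuantumFields-19200`), modules M3 + M4′ (lead g29 00:11Z: «M3 `LettersAt` → M4 `thm2TorusAt_exists_of_letters`»).  WHAT IS REPRODUCED: the recipe of
`B8LeafKnitZd3FourPrinted.fourPrinted_zd3_map_lettersRDUB` (n05-d) restricted to Theorem 2 and to the torus index map `B8Thm2TorusMember.torusIdx`: the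
letters `SLet` (existence side: [4] Thm 3.1 ∕ 3.3 operators `g = G`, `Δ`, `q = Q′`, `qs = Q′*`, `Aw`, `c`, `H′` with their laws and bounds on print's
domains, `B8SockLettersRD.SockLettersRD`), `SLetUB` (uniqueness side: the twelve laws at the top structure) and `SB9all` (the in-edge [4] Thm 3.3 in
Proposition 3's frame at every truncation, `B8LeafModelZd3.SockB9P3`) AT EVERY TORUS MEMBER give the three Proposition-5 sockets BY NAME
(`B8SockHFPRD.exists_threshold_sockHFP_pairRD`, `B8SockP5uEAssemblyB.exists_threshold_sockP5uEB`); the member laws `hL1`, `hL2lt`, `hL2top` of that recipe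
HOLD for the torus index (`Ω_j = ℤᵈ`, `Λ_j = {top lattice}`, proved here); then `B8Thm2TorusAtSupplier.thm2TorusAt_exists_of_socketsE`.  Kind: theorems
only; no `def`, no `… : Prop` fact; no existing module modified.

## THE LETTERS AT A TORUS MEMBER (the interface to sub-row «G-B9-LETTERS»; names for `B9-LETTERS-MAP.md` §6)
* `SLet t`   = `SockLettersRD L BG BR B₀'H B₂' cL η k (fun _ ↦ univ) (fun m ↦ torusLam m)` — [4] Thm 3.1 (G = `g`, its sup and gradient bounds `BG`; the
  range law `R`: `BR`), Thm 3.3 (`H′` with `B₀'H`, `B₂'`), the averaging letters `q`∕`qs`∕`Aw`∕`c` and the Landau multiplier law, for every unitary `U₀` with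
  (1.33) below `cL`, at every truncation `1 ≤ n ≤ k`;
* `SLetUB t` = the same twelve laws at the top structure `n = k` in the guarded-uniqueness reading (verbatim the block of `fourPrinted_zd3_map_lettersRDUB`);
* `SB9all t` = `∀ m ≤ k, SockB9P3 L B₀ B₀β cB9 β len η m (fun _ ↦ univ) (fun m ↦ torusLam m) (fun m ↦ torusLamb m)`.

## HONEST SCOPE — what is NOT claimed
(i) The three letters blocks stay HYPOTHESES at torus members: at a general regular background they are [4] Thms 3.1–3.3 for that background (sub-row
«G-B9-LETTERS», not in the tree).  (ii)–(v) as in `B8Thm2TorusAtSupplier` (Hölder datum `β₀ = 0`; existence half only; `G = unitaryUnits`, J-SU open;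
`P = Lᵏ·N`; `d, L ≥ 2`).  Count-neutral; N05 not discharged; nothing continuum ∕ ℝ⁴ ∕ OS ∕ mass-gap ∕ Clay.
-/

noncomputable section

open NormedSpace

namespace Literature.MathematicalPhysics.QuantumFieldTheory.Balaban1983to89.B8Thm2TorusAtLetters

open B7Prop1Explicit (e)
open B7Prop1Local (InBox)
open B7Prop2Explicit (unitaryUnits)
open B7Eq92Concrete (mgauge)
open B8Ineq132 (InAk BondTouches covDerivFwd)
open B8Ineq130 (tlo thi)
open B8Eq119TwistedAxial (Restr129 InAx bgT)
open B8Eq140Level (SideTouches)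
open B8Eq138LandauZd (covLap QT)
open B8Eq1117Concrete (XSpace)
open B8Prop5ContractionKLevel (Bd2)
open B8LambdaSpaceKLevel (wt)
open B7Eq78Linearization (zdBlocking QprimeIter)
open B8Thm4TorusAt (torusLam mem_torusLam_iff)
open B8Thm2TorusAt (Concl2T)
open B8Eq133Hypotheses (Hyp135)
open B8LeafModelZd3 (SockB9P3)
open B8SockLettersRD (SockLettersRD)
open B8SockHFPRD (exists_threshold_sockHFP_pairRD)
open B8SockP5uEAssemblyB (exists_threshold_sockP5uEB)
open B12Ineq417Flat (shiftCfg)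
open B8Thm2TorusMember (TorusMember torusIdx torusLamb mem_torusLamb_iff)
open B8Thm2TorusAtSupplier (thm2TorusAt_exists_of_socketsE)
open QuantumLattice (blockSites blockMap mem_blockSites_iff)

-- the `ℤ^d` sites of `B7Prop1Explicit` are `LSite` here (convention of `B8Thm2TorusAt`).
open B7Prop1Explicit renaming Site → LSite

variable {d : ℕ}

section Letters

variable {𝔸 : Type} [CStarAlgebra 𝔸] [Nontrivial 𝔸]

/-! ### The three member laws of the letters recipe hold for the torus index -/

/-- The constraint sites of the torus index are the top lattice (`rfl` reader). [cite: Balaban1985RegularSpaces, (1.5) p.77, p.77 («Ω_j = T_η»)] -/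
private theorem tI_Λs' {L : ℕ} (hL : 1 ≤ L) (t : TorusMember) : (torusIdx (d := d) hL t).Λs = fun m => torusLam m := rfl

/-- Law `hL1` for the torus index: the boxes over constraint sites lie in `Ω_n = ℤᵈ`. [cite: Balaban1985RegularSpaces, p.77 («Ω_j = T_η»)] -/
theorem torus_law_box {L : ℕ} (hL : 1 ≤ L) (t : TorusMember) :
    ∀ m, m ≤ (torusIdx (d := d) hL t).k → ∀ n, n ≤ m → ∀ y ∈ (torusIdx (d := d) hL t).Λs m n, ∀ x,
      InBox (tlo L y n) (thi L y n) x → x ∈ (torusIdx (d := d) hL t).Ω n :=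
  fun _ _ _ _ _ _ x _ => Set.mem_univ x

/-- Law `hL2lt` for the torus index: below the top both truncations have no constraint sites. [cite: Balaban1985RegularSpaces, (1.5) p.77] -/
theorem torus_law_lt {L : ℕ} (hL : 1 ≤ L) (t : TorusMember) :
    ∀ m, m < (torusIdx (d := d) hL t).k → ∀ n, n < m →
      (torusIdx (d := d) hL t).Λs m n = (torusIdx (d := d) hL t).Λs (m + 1) n := by
  intro m _ n hn
  rw [tI_Λs']
  ext x
  simp only [mem_torusLam_iff]
  omega

/-- Law `hL2top` for the torus index: the top lattice of the `m`-truncation is blocked from the top lattice of the `(m+1)`-truncation.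
[cite: Balaban1985RegularSpaces, (1.5) p.77] -/
theorem torus_law_top {L : ℕ} (hL : 1 ≤ L) (t : TorusMember) :
    ∀ m, m < (torusIdx (d := d) hL t).k → ∀ x, x ∈ (torusIdx (d := d) hL t).Λs m m ↔
      x ∈ (torusIdx (d := d) hL t).Λs (m + 1) m ∨ ∃ y ∈ (torusIdx (d := d) hL t).Λs (m + 1) (m + 1), x ∈ blockSites L y := by
  intro m _ x
  haveI : NeZero L := ⟨by omega⟩
  rw [tI_Λs']
  simp only [mem_torusLam_iff]
  constructor
  · intro _
    exact Or.inr ⟨blockMap L x, trivial, (mem_blockSites_iff L _ _).2 rfl⟩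
  · intro _
    trivial

/-- **THEOREM 2 (p. 83) FOR `Ω_j = T_η` FROM [4]'s LETTERS AT THE TORUS MEMBERS — the existence half of `B8Thm2TorusAt.Thm2TorusAt … (unitaryUnits 𝔸) Reg`
(`β₀ = 0`, `P = Lᵏ·N`) at every torus member**, the Proposition-5 sockets discharged from `SLet`, `SLetUB`, `SB9all` (module docstring).
[cite: Balaban1985RegularSpaces, Thm 2 p.83, (1.33)–(1.39) pp.82–83, Prop. 5 (1.106)–(1.109) p.94, Thm 4 p.88; Balaban1985BackgroundPropagators, Thm 3.1 p.397, Thm 3.3 p.398] -/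
theorem thm2TorusAt_exists_of_lettersRDUB (hd2 : 2 ≤ d) {L : ℕ} (hL : 2 ≤ L) (β : ℝ) (len : LSite d → ℝ)
    {B₀ B₀' B₀β cB9 B₀'H B₂' BG BR cL : ℝ} (hB₀ : 0 < B₀) (hB₀' : 0 < B₀') (hB : 2 ≤ 5 * (d : ℝ) * L * B₀) (hB₀β : 0 < B₀β) (hcB9 : 0 < cB9)
    (hB₀'H : 0 < B₀'H) (hB₂' : 0 ≤ B₂') (hBG : 0 ≤ BG) (hBR : 0 ≤ BR) (hcL : 0 < cL)
    (hfree : 3 * (2 * (d : ℝ) * (L : ℝ) ^ 2) * BG * BR ≤ B₀')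
    (SLet : ∀ t : TorusMember, SockLettersRD (𝔸 := 𝔸) L BG BR B₀'H B₂' cL (torusIdx (d := d) (le_trans one_le_two hL) t).η (torusIdx (d := d) (le_trans one_le_two hL) t).k (torusIdx (d := d) (le_trans one_le_two hL) t).Ω (torusIdx (d := d) (le_trans one_le_two hL) t).Λs)
    (SLetUB : ∀ t : TorusMember, ∀ α₀ : ℝ, 0 < α₀ → α₀ ≤ cL → ∀ U₀ : LSite d → Fin d → 𝔸ˣ, (∀ x κ, U₀ x κ ∈ unitaryUnits 𝔸) →
      InAk L (torusIdx (d := d) (le_trans one_le_two hL) t).k (torusIdx (d := d) (le_trans one_le_two hL) t).η α₀ (torusIdx (d := d) (le_trans one_le_two hL) t).Ω U₀ →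
      ∃ (g Δ : (LSite d → 𝔸) →ₗ[ℂ] (LSite d → 𝔸)) (q : (LSite d → 𝔸) →ₗ[ℂ] (ℕ → LSite d → 𝔸)) (qs : (ℕ → LSite d → 𝔸) →ₗ[ℂ] (LSite d → 𝔸))
        (Aw c : (ℕ → LSite d → 𝔸) →ₗ[ℂ] (ℕ → LSite d → 𝔸)) (H' : XSpace d (torusIdx (d := d) (le_trans one_le_two hL) t).k 𝔸 →ₗ[ℂ] (LSite d → 𝔸)),
        (∀ x : LSite d → 𝔸, (∃ C : ℝ, ∀ y, ‖x y‖ ≤ C) → g (Δ x + qs (Aw (q x))) = x) ∧ (∀ φ, qs (c (q (g (g (qs φ))))) = qs φ) ∧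
        (∀ (f : LSite d → 𝔸), ∀ x ∈ (torusIdx (d := d) (le_trans one_le_two hL) t).Ω 0, Δ f x = covLap (torusIdx (d := d) (le_trans one_le_two hL) t).η U₀ (((torusIdx (d := d) (le_trans one_le_two hL) t).Ω 0).indicator f) x) ∧
        (∀ (μ : ℕ → LSite d → 𝔸), ∀ x ∈ (torusIdx (d := d) (le_trans one_le_two hL) t).Ω 0, qs μ x = QT L (torusIdx (d := d) (le_trans one_le_two hL) t).k ((torusIdx (d := d) (le_trans one_le_two hL) t).Λs (torusIdx (d := d) (le_trans one_le_two hL) t).k) U₀ μ x) ∧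
        (∀ (f : LSite d → 𝔸) (n : ℕ), n ≤ (torusIdx (d := d) (le_trans one_le_two hL) t).k → ∀ y ∈ (torusIdx (d := d) (le_trans one_le_two hL) t).Λs (torusIdx (d := d) (le_trans one_le_two hL) t).k n, q f n y = QprimeIter (zdBlocking d L) (bgT L U₀) n f y) ∧
        (∀ (f : LSite d → 𝔸) (n : ℕ) (y : LSite d), ¬ (n ≤ (torusIdx (d := d) (le_trans one_le_two hL) t).k ∧ y ∈ (torusIdx (d := d) (le_trans one_le_two hL) t).Λs (torusIdx (d := d) (le_trans one_le_two hL) t).k n) → q f n y = 0) ∧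
        (∀ (X : XSpace d (torusIdx (d := d) (le_trans one_le_two hL) t).k 𝔸) (x : LSite d), ‖H' X x‖ ≤ B₀'H * ‖X‖) ∧
        (∀ n, n ≤ (torusIdx (d := d) (le_trans one_le_two hL) t).k → ∀ (X : XSpace d (torusIdx (d := d) (le_trans one_le_two hL) t).k 𝔸), ∀ p ∈ {b : LSite d × Fin d | SideTouches ((torusIdx (d := d) (le_trans one_le_two hL) t).Ω n) b.1 b.2},
          wt L (torusIdx (d := d) (le_trans one_le_two hL) t).η n * ‖covDerivFwd (torusIdx (d := d) (le_trans one_le_two hL) t).η U₀ p.2 (H' X) p.1‖ ≤ B₀'H * ‖X‖) ∧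
        (∀ X : XSpace d (torusIdx (d := d) (le_trans one_le_two hL) t).k 𝔸, Bd2 L (torusIdx (d := d) (le_trans one_le_two hL) t).η (torusIdx (d := d) (le_trans one_le_two hL) t).k (torusIdx (d := d) (le_trans one_le_two hL) t).Ω (covLap (torusIdx (d := d) (le_trans one_le_two hL) t).η U₀ (H' X)) (B₂' * ‖X‖)) ∧
        (∀ (Y : XSpace d (torusIdx (d := d) (le_trans one_le_two hL) t).k 𝔸) (n : ℕ) (hn : n ≤ (torusIdx (d := d) (le_trans one_le_two hL) t).k) (y : LSite d), y ∈ (torusIdx (d := d) (le_trans one_le_two hL) t).Λs (torusIdx (d := d) (le_trans one_le_two hL) t).k n →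
          QprimeIter (zdBlocking d L) (bgT L U₀) n (H' Y) y = Y (⟨n, Nat.lt_succ_of_le hn⟩, y)) ∧
        (∀ (f : LSite d → 𝔸) (r : ℝ), 0 ≤ r → Bd2 L (torusIdx (d := d) (le_trans one_le_two hL) t).η (torusIdx (d := d) (le_trans one_le_two hL) t).k (torusIdx (d := d) (le_trans one_le_two hL) t).Ω f r →
          (∀ x, ‖g f x‖ ≤ BG * r) ∧ ∀ n, n ≤ (torusIdx (d := d) (le_trans one_le_two hL) t).k → ∀ p ∈ {b : LSite d × Fin d | SideTouches ((torusIdx (d := d) (le_trans one_le_two hL) t).Ω n) b.1 b.2},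
            wt L (torusIdx (d := d) (le_trans one_le_two hL) t).η n * ‖covDerivFwd (torusIdx (d := d) (le_trans one_le_two hL) t).η U₀ p.2 (g f) p.1‖ ≤ BG * r) ∧
        (∀ (f : LSite d → 𝔸) (r : ℝ), 0 ≤ r → Bd2 L (torusIdx (d := d) (le_trans one_le_two hL) t).η (torusIdx (d := d) (le_trans one_le_two hL) t).k (torusIdx (d := d) (le_trans one_le_two hL) t).Ω f r → Bd2 L (torusIdx (d := d) (le_trans one_le_two hL) t).η (torusIdx (d := d) (le_trans one_le_two hL) t).k (torusIdx (d := d) (le_trans one_le_two hL) t).Ω (f - g (qs (c (q (g f))))) (BR * r)))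
    (SB9all : ∀ t : TorusMember, ∀ m, m ≤ (torusIdx (d := d) (le_trans one_le_two hL) t).k → SockB9P3 (𝔸 := 𝔸) L B₀ B₀β cB9 β len (torusIdx (d := d) (le_trans one_le_two hL) t).η m (torusIdx (d := d) (le_trans one_le_two hL) t).Ω (torusIdx (d := d) (le_trans one_le_two hL) t).Λs (torusIdx (d := d) (le_trans one_le_two hL) t).Λb) :
    ∃ B₁ B₂ c₁ : ℝ, 0 < B₁ ∧ 0 < B₂ ∧ 0 < c₁ ∧
      ∀ t : TorusMember, ∀ N : ℤ, ∀ α₀ α₁ : ℝ, 0 < α₀ → 0 < α₁ → α₀ + α₁ ≤ c₁ →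
        ∀ U₀ U' : LSite d → Fin d → 𝔸ˣ, (∀ x κ, U₀ x κ ∈ unitaryUnits 𝔸) → (∀ x κ, U' x κ ∈ unitaryUnits 𝔸) →
          (∀ i : Fin d, shiftCfg ((((L : ℤ) ^ t.k * N)) • e i) U₀ = U₀) → (∀ i : Fin d, shiftCfg ((((L : ℤ) ^ t.k * N)) • e i) U' = U') →
          InAk L t.k t.η α₀ (fun _ => Set.univ) U₀ →
          InAk L t.k t.η α₀ (fun _ => Set.univ) (U' * U₀) → InAx L t.k (torusLam t.k) U₀ (U' * U₀) →
          Hyp135 L t.k (torusLam t.k) α₁ U₀ U' →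
          ∃ u : LSite d → 𝔸ˣ, (∀ x, u x ∈ unitaryUnits 𝔸) ∧ (∀ (x : LSite d) (i : Fin d), u (x + (((L : ℤ) ^ t.k * N)) • e i) = u x) ∧
            Restr129 L t.k (torusLam t.k) U₀ u ∧
            Concl2T L t.k ((L : ℤ) ^ t.k * N) t.η 0 B₁ B₂ len α₀ α₁ U₀ U' u := by
  have hL1 : 1 ≤ L := le_trans one_le_two hL
  obtain ⟨cF, hcF, hpair⟩ := exists_threshold_sockHFP_pairRD (𝔸 := 𝔸) hd2 hL hB₀ hB₀' hB hB₀'H hB₂' hBG hBR hcB9 hcL hfree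
  obtain ⟨cu, cFu, hcu, hcFu, huniq⟩ := exists_threshold_sockP5uEB (𝔸 := 𝔸) hd2 hL hB₀ hB hB₀'H hB₂' hBG hBR hcB9 hcL
  have SHFP₀ := fun t : TorusMember =>
    (hpair (torusIdx (d := d) hL1 t).hη (torusIdx (d := d) hL1 t).hk (torusIdx (d := d) hL1 t).hΩ
      (torusIdx (d := d) hL1 t).hbox (torusIdx (d := d) hL1 t).hclass (torus_law_box (d := d) hL1 t)
      (torus_law_lt (d := d) hL1 t) (torus_law_top (d := d) hL1 t) (SLet t) (SB9all t)).1
  have SHFP := fun t : TorusMember =>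
    (hpair (torusIdx (d := d) hL1 t).hη (torusIdx (d := d) hL1 t).hk (torusIdx (d := d) hL1 t).hΩ
      (torusIdx (d := d) hL1 t).hbox (torusIdx (d := d) hL1 t).hclass (torus_law_box (d := d) hL1 t)
      (torus_law_lt (d := d) hL1 t) (torus_law_top (d := d) hL1 t) (SLet t) (SB9all t)).2
  have SP5u := fun t : TorusMember =>
    huniq (torusIdx (d := d) hL1 t).hη (torusIdx (d := d) hL1 t).hk (torusIdx (d := d) hL1 t).hΩ rfl
      (torusIdx (d := d) hL1 t).hbox (torusIdx (d := d) hL1 t).hclass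
      ((torus_law_box (d := d) hL1 t) (torusIdx (d := d) hL1 t).k le_rfl) (SLetUB t) (SB9all t)
  exact thm2TorusAt_exists_of_socketsE hd2 hL hB₀ hB₀' hB₀β hB hcu hcF hcF hcFu hcB9 SHFP₀ SHFP SP5u SB9all

end Letters

#print axioms thm2TorusAt_exists_of_lettersRDUB

end Literature.MathematicalPhysics.QuantumFieldTheory.Balaban1983to89.B8Thm2TorusAtLetters

end
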